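import Summits.QuantumFields.BalabanUV.Gaps.EndDrawdownBand
import Summits.QuantumFields.BalabanUV.Gaps.CapTailEndNecessity
import Summits.QuantumFields.BalabanUV.Gaps.WeakestBetaCurrency
import Literature.MathematicalPhysics.QuantumFieldTheory.Balaban1983to89.Beta.RemainderResidue

/-!
# Gaps / EndDrawdownSandwich — the drawdown node BY NAME on the tree's two END-grade files of this seat: (i) SUFFICIENCY — bounded drawdown
# `DwSeq β⁰ rlo` + `β⁰` bounded above + the one-sided remainder class + (C) FILL the 2 × 2 table `WeakestBetaCurrency.Quarters` at the
# DEGENERATE SLOPE `b := rlo` (so the table's slope field is redundant at END grade, and every table inhabitant gives the node back);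
# (ii) NECESSITY — `CapTailEndNecessity.windowSum_lower_of_endpointExistence`'s conclusion IS `DwSeq β⁰ (−rr)` (shape equivalence); (iii) the CLOSED cases of the sandwich
# `DwSeq β⁰ rlo ⟹ E ⟹ DwSeq β⁰ (−rhi)`: a remainder PINNED to a constant on the positive histories (`rhi = −rlo`), in particular the pure
# one-loop caricature `rr = 0`, gives `E ⟺ DwSeq β⁰ rlo` on the nose; (iv) the FULLY WINDOWED supplier — the node on the `β⁰` side joined with
# g1-p2's windowed one-sided (D4)-currency `Beta.RemainderResidue.WindowedLower` on the `β¹` side (kernel §11 `End_of_Dw_windowedLower_Up_T3`),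
# here through the per-level socket.  A PORT into the tree, with attribution, of g1-plan-2 GEN 22's HOME
# kernel `HOME/g1/skeletons/B12Thm2SubDag_plan2.lean` v1.15 (sha16 6167da52388d3b3c) §11b (`Dw_B0_of_quarters`, `quartersOfDw`,
# `End_of_Dw_B0_T2_T3_byName`, `Dw_neg_of_End_T2`, `End_sandwich_Dw`, `End_iff_Dw_zero`) and §11 (`PS_of_Dw_windowedLower`,
# `End_of_Dw_windowedLower_Up_T3`), B0-free where the tree allows (cell pub-balaban-gaps,
# seat g1-p3 GEN 8, rows CAP ∕ tail «split ∕ weakening»; file 3 of «the one-loop interface of the END statement»)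

HONEST FRAMING (cell rule, page 1 of everything): identifications BY NAME between tree files + two-line corollaries; hypothesis SHAPES on the
tree's typed carriers; `EndpointExistence C` (the cell's END-grade statement; [I] Thm 2 p. 259 first sentence, UNPRINTED) is a conclusion of
∕ inside an equivalence with hypotheses named in the signature.  NO NOVELTY CLAIMED over `WeakestBetaCurrency` (gen 0), `CapTailEndNecessity`
(gen 5) or `EndDrawdownBand` (this gen): this file records that they are the two halves of ONE node.  AUTHORSHIP: mathematics g1-plan-2 GEN 22's
(planner seat; «g1-p3 ports with attribution»); this seat: the B0-free END direction (via `EndDrawdownBand`), the pinned-remainder closing case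
(marked (this seat)), header, docstrings, re-check.  Nothing of Bałaban's asserted; no remainder constant, no `β⁰_k`, no limit certified
(NODE-O instance 0∕1, CAP coefficients certified 0); 0∕6 binders; one finite T⁴; NOT [I] Thm 2, NOT `BetaPertH`, NOT the continuum limit, NOT Clay.

CITATION HEADER (tags CONTEXT ONLY).  [I] = T. Bałaban, Commun. Math. Phys. **109** (1987) 249–301 [Balaban1987RG1]: Thm 2 p. 259 (first
sentence), (0.20) p. 256, (2.12)–(2.14) p. 268.
-/

namespace Summit.QuantumFields.BalabanUV.Gaps.EndDrawdownSandwich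

open Literature.MathematicalPhysics.QuantumFieldTheory.Balaban1983to89
open Literature.MathematicalPhysics.QuantumFieldTheory.Balaban1983to89.FlowStep
open Literature.MathematicalPhysics.QuantumFieldTheory.Balaban1983to89.FlowStepRuns
open Literature.MathematicalPhysics.QuantumFieldTheory.Balaban1983to89.DagBinding
open Literature.MathematicalPhysics.QuantumFieldTheory.Balaban1983to89.Beta.RemainderChain (RemainderConst)
open Summit.QuantumFields.BalabanUV.Gaps.EndDrawdownSeq
open Summit.QuantumFields.BalabanUV.Gaps.EndDrawdownBand
open Summit.QuantumFields.BalabanUV.Gaps.WeakestBetaCurrency (Quarters)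
open Summit.QuantumFields.BalabanUV.Gaps.CapTailEndNecessity (windowSum_lower_of_endpointExistence)
open Summit.QuantumFields.BalabanUV.Gaps.EndUpperPerLevel (endpointExistence_of_partialSums_locUpper)
open Literature.MathematicalPhysics.QuantumFieldTheory.Balaban1983to89.Beta.RemainderResidue (WindowedLower)
open Finset

noncomputable section

variable {β : HBeta}

/-! ## §1 SUFFICIENCY BY NAME: the node fills this seat's 2 × 2 table `Quarters` at the degenerate slope (kernel §11b, ported) -/

/-- EVERY INHABITANT of the 2 × 2 table gives the drawdown node at its lower remainder threshold `Q.r` (bound `2A`: (Q1) ∧ the coupling `r ≤ b`)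
and `β⁰` bounded above ((Q2)) — so of the table's slope `b` only `r ≤ b` is ever used at END grade (kernel §11b `Dw_B0_of_quarters`). [folklore] -/
theorem dwSeq_bddAbove_of_quarters {Sβ : B12Beta.OneLoopSplit β} (Q : Quarters Sβ) :
    DwSeq Sβ.β0 Q.r ∧ ∃ B : ℝ, ∀ j, Sβ.β0 j ≤ B := by
  refine ⟨⟨2 * Q.A, fun k n hkn => ?_⟩, ⟨Q.B, Q.q2⟩⟩
  have h1 := Q.q1 k n hkn
  have hnk : (0 : ℝ) ≤ (n : ℝ) - k := by
    have : (k : ℝ) ≤ n := by exact_mod_cast hkn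
    linarith
  have hbr : Q.r * ((n : ℝ) - k) ≤ Q.b * ((n : ℝ) - k) := mul_le_mul_of_nonneg_right Q.hr hnk
  rw [sum_Ico_sub_const Sβ.β0 Q.r hkn]
  linarith

/-- … and its remainder rows are the one-sided class `[−Q.r, Q.r′]` on `]0, Q.γ₀]` (this seat). [folklore] -/
theorem remainderLU_of_quarters {Sβ : B12Beta.OneLoopSplit β} (Q : Quarters Sβ) : RemainderLU Sβ Q.γ₀ Q.r Q.r' :=
  fun k p hp => ⟨Q.q3 k p hp, Q.q4 k p hp⟩

/-- CONVERSELY, bounded drawdown `DwSeq β⁰ rlo` ∧ `β⁰` bounded above ∧ the one-sided class `[−rlo, rhi]` on `]0,γ₀]` ∧ (C) FILL the table at the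
DEGENERATE SLOPE `b := rlo` (`A := M∕2`, `r := rlo` with the coupling `r ≤ b` by `le_rfl`, `r′ := rhi`) — hypothesis carrier → hypothesis carrier;
nothing asserted (kernel §11b `quartersOfDw` ∕ §12c `quartersOfDwLU`, stated as inhabitation to keep this file definition-free). [folklore] -/
theorem nonempty_quarters_of_dwSeq_bddAbove (Sβ : B12Beta.OneLoopSplit β) {γ₀ rlo rhi : ℝ} (hγ₀ : 0 < γ₀) (hDw : DwSeq Sβ.β0 rlo)
    (hB0 : ∃ B : ℝ, ∀ j, Sβ.β0 j ≤ B) (hrem : RemainderLU Sβ γ₀ rlo rhi) (hcont : BetaContH γ₀ β) :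
    ∃ Q : Quarters Sβ, Q.γ₀ = γ₀ ∧ Q.b = rlo ∧ Q.r = rlo ∧ Q.r' = rhi := by
  obtain ⟨M, hM⟩ := hDw
  obtain ⟨B, hB⟩ := hB0
  have hq1 : ∀ k n : ℕ, k ≤ n → rlo * ((n : ℝ) - k) - 2 * (M / 2) ≤ ∑ j ∈ Finset.Ico k n, Sβ.β0 j := fun k n hkn => by
    have h := hM k n hkn
    rw [sum_Ico_sub_const Sβ.β0 rlo hkn] at h
    linarith
  exact ⟨⟨γ₀, hγ₀, rlo, M / 2, hq1, B, hB, rlo, fun k p hp => (hrem k p hp).1, le_rfl, rhi, fun k p hp => (hrem k p hp).2, hcont⟩,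
    rfl, rfl, rfl, rfl⟩

/-- THE B0-KEYED END EDGE BY NAME · fwd-gen ∧ `DwSeq β⁰ rlo` ∧ `β⁰` bounded above ∧ `[−rlo, rhi]`-class ∧ (C) ⟹ E through this seat's
`Quarters.endpointExistence` (gen 0, p339949 ✓) — the kernel's §11 edge `End_of_Dw_B0_T2_T3` IS the table's END theorem at the degenerate slope
(kernel §11b `End_of_Dw_B0_T2_T3_byName` ∕ §12c `End_of_DwLo_B0_LU_C`).  `EndDrawdownBand.endpointExistence_of_dwSeq_remainderLU` is the same edge
with the bounded-above hypothesis DELETED (per-level socket). [cite: Balaban1987RG1, Thm 2 p.259 (first sentence)] -/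
theorem endpointExistence_of_dwSeq_bddAbove_viaQuarters {Cn : B12.Construction} (hgen : ForwardGenerated Cn β)
    (Sβ : B12Beta.OneLoopSplit β) {γ₀ rlo rhi : ℝ} (hγ₀ : 0 < γ₀) (hDw : DwSeq Sβ.β0 rlo) (hB0 : ∃ B : ℝ, ∀ j, Sβ.β0 j ≤ B)
    (hrem : RemainderLU Sβ γ₀ rlo rhi) (hcont : BetaContH γ₀ β) : EndpointExistence Cn := by
  obtain ⟨Q, -⟩ := nonempty_quarters_of_dwSeq_bddAbove Sβ hγ₀ hDw hB0 hrem hcont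
  exact Q.endpointExistence hgen

/-- ROUND TRIP · every table inhabitant's END (this seat's `Quarters.endpointExistence`) factors through the B0-free node edge of `EndDrawdownBand`:
the bounded-above row (Q2) and the slope `b` are NOT consumed (this seat). [cite: Balaban1987RG1, Thm 2 p.259 (first sentence)] -/
theorem quarters_endpointExistence_via_node {Sβ : B12Beta.OneLoopSplit β} (Q : Quarters Sβ) {Cn : B12.Construction}
    (hgen : ForwardGenerated Cn β) : EndpointExistence Cn :=
  endpointExistence_of_dwSeq_remainderLU hgen Sβ Q.γ₀_pos (dwSeq_bddAbove_of_quarters Q).1 (remainderLU_of_quarters Q) Q.cont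

/-! ## §2 NECESSITY: `CapTailEndNecessity` §6's conclusion IS the node at threshold `−rr` (kernel §11b, ported as a shape equivalence) -/

/-- NECESSITY BY NAME · this seat's gen-5 `CapTailEndNecessity.windowSum_lower_of_endpointExistence` (fwd-gen ∧ `RemainderConst Sβ γ₀ rr` ∧ E ⟹ the window sums
of `β⁰ + rr` are bounded below) and `EndDrawdownBand.dwSeq_neg_of_endpointExistence_remainderConst` (E ⟹ `DwSeq β⁰ (−rr)`, one-sided proof) conclude the SAME
thing — the two conclusion shapes are equivalent term by term (`x + rr = x − (−rr)`); recorded as an `Iff` so that either tree theorem feeds the node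
(kernel §11b `Dw_neg_of_End_T2`; the by-name derivation itself is not restated — it IS the landed `dwSeq_neg_of_endpointExistence_remainderConst`). [folklore] -/
theorem windowSum_lower_iff_dwSeq_neg (Sβ : B12Beta.OneLoopSplit β) (rr : ℝ) :
    (∃ D : ℝ, ∀ k K : ℕ, k ≤ K → -D ≤ ∑ j ∈ Finset.Ico k K, (Sβ.β0 j + rr)) ↔ DwSeq Sβ.β0 (-rr) := by
  constructor
  · rintro ⟨D, hD⟩
    exact ⟨D, fun k n hkn => by simpa only [sub_neg_eq_add] using hD k n hkn⟩
  · rintro ⟨D, hD⟩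
    exact ⟨D, fun k n hkn => by simpa only [sub_neg_eq_add] using hD k n hkn⟩

/-! ## §3 THE SANDWICH over row (D4)'s symmetric class and its CLOSED cases (kernel §11b, ported B0-free; the pinned case this seat) -/

/-- **THE END-GRADE SANDWICH IN ONE NODE** · over the printed split with fwd-gen, `RemainderConst Sβ γ₀ rr` on the box `]0,γ₀]` and (C):
`DwSeq β⁰ rr ⟹ E ⟹ DwSeq β⁰ (−rr)` — ONE node, two thresholds `2·rr` apart (the width of the remainder box); sufficiency = `EndDrawdownBand` (per-level
socket, no B0), necessity BY NAME = `CapTailEndNecessity` §6 (kernel §11b `End_sandwich_Dw`, B0 deleted). [cite: Balaban1987RG1, Thm 2 p.259 (first sentence)] -/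
theorem endpointExistence_sandwich {Cn : B12.Construction} (hgen : ForwardGenerated Cn β) (Sβ : B12Beta.OneLoopSplit β) {γ₀ rr : ℝ}
    (hγ₀ : 0 < γ₀) (hrem : RemainderConst Sβ γ₀ rr) (hcont : BetaContH γ₀ β) :
    (DwSeq Sβ.β0 rr → EndpointExistence Cn) ∧ (EndpointExistence Cn → DwSeq Sβ.β0 (-rr)) :=
  ⟨fun hDw => endpointExistence_of_dwSeq_remainderConst hgen Sβ hγ₀ hDw hrem hcont,
    fun hE => dwSeq_neg_of_endpointExistence_remainderConst hgen Sβ hγ₀ hrem hE⟩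

/-- CLOSED CASE 1 · in the pure one-loop caricature (`rr = 0`: the remainder vanishes on the box) the sandwich closes: `E ⟺ DwSeq β⁰ 0`, given (C)
and fwd-gen — the END-grade form of g1-plan-2's S-32 «END ⟺ bounded drawdown», both directions by name, no bound on `β⁰` from above
(kernel §11b `End_iff_Dw_zero`, B0 deleted). [cite: Balaban1987RG1, Thm 2 p.259 (first sentence)] -/
theorem endpointExistence_iff_dwSeq_zero {Cn : B12.Construction} (hgen : ForwardGenerated Cn β) (Sβ : B12Beta.OneLoopSplit β) {γ₀ : ℝ}
    (hγ₀ : 0 < γ₀) (hrem : RemainderConst Sβ γ₀ 0) (hcont : BetaContH γ₀ β) : EndpointExistence Cn ↔ DwSeq Sβ.β0 0 := by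
  obtain ⟨h1, h2⟩ := endpointExistence_sandwich hgen Sβ hγ₀ hrem hcont
  exact ⟨fun hE => by simpa using h2 hE, h1⟩

/-- CLOSED CASE 2 (this seat) · a remainder PINNED between `−rlo` and `−rlo` on the positive `]0,γ₀]`-histories (the one-sided class with `rhi = −rlo`,
i.e. `β¹ ≡ −rlo` there; `rlo` of either sign) closes the one-sided sandwich of `EndDrawdownBand` on the nose: `E ⟺ DwSeq β⁰ rlo` — pure one-loop
up to a constant shift of the line. [cite: Balaban1987RG1, Thm 2 p.259 (first sentence)] -/
theorem endpointExistence_iff_dwSeq_of_pinnedRemainder {Cn : B12.Construction} (hgen : ForwardGenerated Cn β)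
    (Sβ : B12Beta.OneLoopSplit β) {γ₀ rlo : ℝ} (hγ₀ : 0 < γ₀) (hrem : RemainderLU Sβ γ₀ rlo (-rlo)) (hcont : BetaContH γ₀ β) :
    EndpointExistence Cn ↔ DwSeq Sβ.β0 rlo := by
  obtain ⟨h1, h2⟩ := endpointExistence_sandwich_remainderLU hgen Sβ hγ₀ hrem hcont
  exact ⟨fun hE => by simpa using h2 hE, h1⟩

/-- CLOSED CASE 2, quantified (this seat) · over the pinned class `[−rlo, −(−rlo)]`… read: with `rhi := −rlo` the two thresholds of
`EndDrawdownBand` COINCIDE — `EndForcedLU b rlo (−rlo) γ₀ ⟺ DwSeq b rlo ⟺ EndPossibleLU b rlo (−rlo) γ₀`: forced and possible agree exactly when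
the remainder box is a point. [folklore] -/
theorem endForcedLU_iff_endPossibleLU_of_pinned (b : ℕ → ℝ) (rlo : ℝ) {γ₀ : ℝ} (hγ₀ : 0 < γ₀) :
    (EndForcedLU b rlo (-rlo) γ₀ ↔ DwSeq b rlo) ∧ (EndPossibleLU b rlo (-rlo) γ₀ ↔ DwSeq b rlo) := by
  refine ⟨endForcedLU_iff_dwSeq hγ₀ le_rfl, ?_⟩
  rw [endPossibleLU_iff_dwSeq_neg hγ₀ le_rfl, neg_neg]

/-! ## §4 THE FULLY WINDOWED SUPPLIER: the node on the `β⁰` side ∧ g1-p2's `WindowedLower` on the `β¹` side (kernel §11, ported; per-level form this seat) -/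

/-- PLUMBING · bounded drawdown of `β⁰` below the `rr`-line (bound `M`) ∧ g1-p2's windowed one-sided (D4)-currency `WindowedLower Sβ γ₀ rr M′`
(`Σ_{[k,n)} β¹_{j+1} ≥ −(M′ + rr·(n − k))` along every `]0,γ₀]`-sequence) ⟹ the W-β hypothesis `BetaPartialSumsLowerH (M + M′) γ₀ β` — BOTH one-loop
sides windowed, coupled only through the common rate `rr` (kernel §11 `PS_of_Dw_windowedLower`; g1-p2's `betaPartialSumsLowerH_of_drift_windowedLower`
is this edge behind a drift class). [folklore] -/
theorem ps_of_dwSeq_windowedLower (Sβ : B12Beta.OneLoopSplit β) {rr γ₀ M M' : ℝ}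
    (hM : ∀ k n : ℕ, k ≤ n → -M ≤ ∑ j ∈ Finset.Ico k n, (Sβ.β0 j - rr)) (hwin : WindowedLower Sβ γ₀ rr M') :
    BetaPartialSumsLowerH (M + M') γ₀ β := by
  intro g hg k n hkn
  have h1 := hwin g hg k n hkn
  have h0 := hM k n hkn
  have hsplit : ∑ j ∈ Finset.Ico k n, β j (prefixOf g j) =
      ∑ j ∈ Finset.Ico k n, Sβ.β0 j + ∑ j ∈ Finset.Ico k n, Sβ.β1 j (prefixOf g j) := by
    rw [← Finset.sum_add_distrib]
    exact Finset.sum_congr rfl fun j _ => Sβ.split j _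
  rw [sum_Ico_sub_const Sβ.β0 rr hkn] at h0
  rw [hsplit]
  linarith

/-- A `WindowedLower` defect is nonnegative when the box is nonempty (empty window at the constant sequence `γ₀`). [folklore] -/
theorem windowedLower_defect_nonneg (Sβ : B12Beta.OneLoopSplit β) {rr γ₀ M' : ℝ} (hγ₀ : 0 < γ₀) (hwin : WindowedLower Sβ γ₀ rr M') :
    0 ≤ M' := by
  have h := hwin (fun _ => γ₀) (fun _ => ⟨hγ₀, le_rfl⟩) 0 0 le_rfl
  rw [Finset.Ico_self, Finset.sum_empty] at h
  norm_num at h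
  linarith

/-- **THE FULLY WINDOWED END EDGE, PER-LEVEL FORM (this seat)** · fwd-gen ∧ `DwSeq β⁰ rr` ∧ `WindowedLower Sβ γ₀ rr M′` ∧ PER-LEVEL upper bounds on `β`
∧ (C) ⟹ E — the W-β hypothesis supplied with both one-loop sides windowed, the upper side per level through this seat's per-level socket
`EndUpperPerLevel.endpointExistence_of_partialSums_locUpper` (kernel §11 `End_of_Dw_windowedLower_Up_T3` asks the uniform (UP) instead).
[cite: Balaban1987RG1, Thm 2 p.259 (first sentence)] -/
theorem endpointExistence_of_dwSeq_windowedLower_locUpper {Cn : B12.Construction} (hgen : ForwardGenerated Cn β)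
    (Sβ : B12Beta.OneLoopSplit β) {rr γ₀ M' : ℝ} (hγ₀ : 0 < γ₀) (hDw : DwSeq Sβ.β0 rr) (hwin : WindowedLower Sβ γ₀ rr M')
    (hloc : ∀ k : ℕ, ∃ B : ℝ, ∀ v : Fin (k + 1) → ℝ, v ∈ Box γ₀ k → β k v ≤ B) (hcont : BetaContH γ₀ β) :
    EndpointExistence Cn := by
  obtain ⟨M, hM0, hM⟩ := hDw.exists_nonneg
  have hM'0 := windowedLower_defect_nonneg Sβ hγ₀ hwin
  exact endpointExistence_of_partialSums_locUpper hgen hγ₀ (by linarith) hcont (ps_of_dwSeq_windowedLower Sβ hM hwin) hloc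

/-- THE FULLY WINDOWED END EDGE under the printed uniform (UP) (kernel §11 `End_of_Dw_windowedLower_Up_T3` verbatim in substance; the sign condition
`0 ≤ β′` of the kernel is not needed through the per-level socket). [cite: Balaban1987RG1, Thm 2 p.259 (first sentence) and §1 p.264] -/
theorem endpointExistence_of_dwSeq_windowedLower_betaUpperH {Cn : B12.Construction} (hgen : ForwardGenerated Cn β)
    (Sβ : B12Beta.OneLoopSplit β) {rr γ₀ M' β' : ℝ} (hγ₀ : 0 < γ₀) (hDw : DwSeq Sβ.β0 rr) (hwin : WindowedLower Sβ γ₀ rr M')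
    (hup : BetaUpperH β' γ₀ β) (hcont : BetaContH γ₀ β) : EndpointExistence Cn :=
  endpointExistence_of_dwSeq_windowedLower_locUpper hgen Sβ hγ₀ hDw hwin (fun k => ⟨β', fun v hv => hup k v hv⟩) hcont

end

end Summit.QuantumFields.BalabanUV.Gaps.EndDrawdownSandwich
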